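/-
Origin: expansion seat `planner-pub-hodgecm-toy2-g5-0`, handover #12 2026-08-18T09:42:10Z (`HOME/pub-hodgecm-toy2-g5/lean/Toy2g5/ToyCupScale.lean`, md5 b2311878, 396 lines);
landed by the gen-7 packager in gate run 27 as `HodgeCM/Model/Toy/ToyCupScale.lean` (import ^import Toy2g5\.ToyPadH0FundDescent\b→import HodgeCM.Model.Toy.ToyPadH0FundDescent ×1; stripped 4 #print/#check/#eval lines).
-/
/-
Copyright: pub-hodgecm formalisation cell (harness21, 2026). New file (not vendored).
Origin: HOME/pub-hodgecm-toy2-g5/lean/Toy2g5/ToyCupScale.lean — session planner-pub-hodgecm-toy2-g5-0 (unit pub-hodgecm-toy2-g5,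
CONSISTENCY seat 2, part (6a)(ii), generation 5).  WIP module `Toy2g5.ToyCupScale`; intended final place
`HodgeCM/Model/Toy/ToyCupScale.lean` (module `HodgeCM.Model.Toy.ToyCupScale`).  ONE import to rewrite on landing:
`Toy2g5.ToyPadH0FundDescent` ↦ `HodgeCM.Model.Toy.ToyPadH0FundDescent`.
-/
import Summits.HodgeConjecture.HodgeCM.Model.Toy.ToyPadH0FundDescent

/-!
# F5 `Fact_cupAssoc` is independent: rescaling one cup product

Nothing in the axiom list pins the cup product `H² ⊗ H³ → H⁵`: M3 (naturality), M4/N2 (Hodge filtration), M9/F4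
(algebraic classes), F7d (Gysin descent) are invariant under rescaling a `cup X i j` by a nonzero constant; M19, M20,
M23, M26, F7, `Fact_unitH0` and N1 (`cupPow`, bracketed to the LEFT, only uses `cup X (k+1) 1`) never mention the
degree pair `(2, 3)`.  Only F5 (associativity) does: `(a ∪ b) ∪ c` with `deg a = 2, deg b = 3` uses it, `a ∪ (b ∪ c)`
does not.

* `U.scaleCup := {U with cup X 2 3 := 2 • cup X 2 3}` (all other `cup X i j` unchanged) — generic, for ANY universe;
* `ScaleCup.modelAxioms : U.ModelAxioms → U.scaleCup.ModelAxioms` and the transfer of N1–N4, F4, F7, F7d, F7d-B,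
  `Fact_unitH0`, N5, `Fact_dimProd`, `W_RK4`, `PohlmannSpan`, `Qw8MilnePos`, `CMProdH0Nontrivial`, `HC_CM`;
* `ScaleCup.not_fact_cupAssoc`: if `U` is associative and has classes `a ∈ H², b ∈ H³, c ∈ H¹` with `(a ∪ b) ∪ c ≠ 0`,
  then **F5 FAILS in `U.scaleCup`** (`2w = w` forces `w = 0`);
* `Universe.exists_cup_triple_ne_zero`: such classes exist as soon as N1, F5 hold and some CM product has `H⁶ ≠ 0`
  (`cupPow X 5 a ≠ 0` for some `a`, re-bracketed by F5);
* in `toyModel` the CM threefold `A_{(ℚ(ζ₇),Φ)}` has `H⁶ = ⋀⁶ ℚ⁶ ≠ 0` (the tree's `cyclo7`, `[ℚ(ζ₇):ℚ] = 6`).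

Headline `HodgeCM.Toy.fact_cupAssoc_independent`: F5 is independent of
`ModelAxioms ∧ N1 ∧ N2 ∧ N3 ∧ N4 ∧ F4 ∧ F7 ∧ F7d ∧ F7d-B ∧ Fact_unitH0 ∧ N5 ∧ Fact_dimProd ∧ W_RK4 ∧ PohlmannSpan ∧ Qw8MilnePos ∧
CMProdH0Nontrivial` (`CupContext`; `toyModel`: F5 true, `cupModel := toyModel.scaleCup`: F5 false; both satisfy `HC_CM`).
FACTS §1c P5 row F5 ('none filed').  Nothing is cited; Lean + Mathlib axioms only.
-/

noncomputable section

open scoped TensorProduct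

namespace HodgeCM

open Literature.AlgebraicGeometry.Motives (CMType HodgeStructure)

namespace Universe

variable {U : Universe}

/-- **Rescaled cup product**: `cup X 2 3` is doubled, every other `cup X i j` is kept (the test is on `j` first, so that
`cup X (k+1) 1`, the only shape `cupPow` uses, reduces by `decide`-evaluation at a variable `k`). -/
abbrev scaleCup (U : Universe) : Universe :=
  { U with cup := fun X i j => if j = 3 ∧ i = 2 then (2 : ℚ) • U.cup X i j else U.cup X i j }

namespace ScaleCup

/-- (Ported verbatim from the HodgeCMPerL package; no docstring in the source.) -/
theorem cup_of_ne {X : U.Var} {i j : ℕ} (h : ¬ (j = 3 ∧ i = 2)) : U.scaleCup.cup X i j = U.cup X i j := if_neg h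

/-- (Ported verbatim from the HodgeCMPerL package; no docstring in the source.) -/
theorem cup_of_pos {X : U.Var} {i j : ℕ} (h : j = 3 ∧ i = 2) : U.scaleCup.cup X i j = (2 : ℚ) • U.cup X i j := if_pos h

/-- (Ported verbatim from the HodgeCMPerL package; no docstring in the source.) -/
theorem cup_two_three (X : U.Var) : U.scaleCup.cup X 2 3 = (2 : ℚ) • U.cup X 2 3 := rfl

/-! ### The axioms that mention a cup product of variable degree: M3, M4, M26 -/

set_option smartUnfolding false in
/-- M3 (naturality) is invariant under rescaling. -/
theorem pull_cup (h : U.Fact_pull_cup) : U.scaleCup.Fact_pull_cup := by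
  intro X Y f i j x y
  by_cases hc : j = 3 ∧ i = 2
  · rw [cup_of_pos hc, cup_of_pos hc, LinearMap.smul_apply, LinearMap.smul_apply, LinearMap.smul_apply,
      LinearMap.smul_apply, map_smul]
    exact congrArg ((2 : ℚ) • ·) (h X Y f i j x y)
  · rw [cup_of_ne hc, cup_of_ne hc]
    exact h X Y f i j x y

set_option smartUnfolding false in
/-- (Ported verbatim from the HodgeCMPerL package; no docstring in the source.) -/
theorem cup2C_eq (X : U.Var) (k : ℕ) : U.scaleCup.cup2C X k = U.cup2C X k := by
  unfold Universe.cup2C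
  rw [cup_of_ne (X := X) (i := k) (j := k) (by omega)]

set_option smartUnfolding false in
/-- M4 transfers (`cup X k k` is never the rescaled one). -/
theorem cup2_hodge (h : U.Fact_cup2_hodge) : U.scaleCup.Fact_cup2_hodge := by
  intro X k p q x y hx hy
  rw [cup2C_eq]
  exact h X k p q x y hx hy

set_option smartUnfolding false in
/-- M26 transfers (`cup X 4 _` is never the rescaled one). -/
theorem gysin_surface (h : U.Fact_gysin_surface) : U.scaleCup.Fact_gysin_surface := by
  intro S X f hS
  obtain ⟨c, hc, hyc⟩ := h S X f hS
  refine ⟨c, hc, fun y => ?_⟩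
  rw [cup_of_ne (by omega)]
  exact hyc y

set_option smartUnfolding false in
/-- **All 28 `ModelAxioms` transfer to `U.scaleCup`** (25 by definitional unfolding — the axioms with literal cup degrees
`(1,1)`, `(2,2)` included —, M3/M4/M26 by the three lemmas above). -/
theorem modelAxioms (M : U.ModelAxioms) : U.scaleCup.ModelAxioms where
  pull_id := M.pull_id
  pull_comp := M.pull_comp
  pull_cup := pull_cup M.pull_cup
  pull_hodge := M.pull_hodge
  cup2_hodge := cup2_hodge M.cup2_hodge
  tr_degree := M.tr_degree
  alg_le_hodge := M.alg_le_hodge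
  pull_alg := M.pull_alg
  cup_alg := M.cup_alg
  lefschetz11 := M.lefschetz11
  cmAV := M.cmAV
  eigenLine := M.eigenLine
  alphaLine := M.alphaLine
  cmDominated := M.cmDominated
  weilLine_rank := M.weilLine_rank
  weilLine_hodge := M.weilLine_hodge
  pms_dim := M.pms_dim
  lift := M.lift
  cup_comm1 := M.cup_comm1
  cup_interchange := M.cup_interchange
  kunneth1 := M.kunneth1
  H1_rank := M.H1_rank
  H4_span := M.H4_span
  cmEnd := M.cmEnd
  conjIsogeny := M.conjIsogeny
  gysin_surface := gysin_surface M.gysin_surface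
  deg_diag := M.deg_diag
  algDuality := M.algDuality

/-! ### The cup-free inputs and N1 transfer definitionally -/

set_option smartUnfolding false in
/-- N1: `cupPow` only uses `cup X (k+1) 1`, which is not rescaled (by evaluation of `1 = 3`). -/
theorem fact_cupExterior_iff : U.scaleCup.Fact_cupExterior ↔ U.Fact_cupExterior := Iff.rfl
set_option smartUnfolding false in
/-- (Ported verbatim from the HodgeCMPerL package; no docstring in the source.) -/
theorem fact_pull_H0_iff : U.scaleCup.Fact_pull_H0 ↔ U.Fact_pull_H0 := Iff.rfl
set_option smartUnfolding false in
/-- (Ported verbatim from the HodgeCMPerL package; no docstring in the source.) -/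
theorem fact_hodge_F0_iff : U.scaleCup.Fact_hodge_F0 ↔ U.Fact_hodge_F0 := Iff.rfl
set_option smartUnfolding false in
/-- (Ported verbatim from the HodgeCMPerL package; no docstring in the source.) -/
theorem fact_fundClass_iff : U.scaleCup.Fact_fundClass ↔ U.Fact_fundClass := Iff.rfl
set_option smartUnfolding false in
/-- (Ported verbatim from the HodgeCMPerL package; no docstring in the source.) -/
theorem fact_dimProd_iff : U.scaleCup.Fact_dimProd ↔ U.Fact_dimProd := Iff.rfl
set_option smartUnfolding false in
/-- (Ported verbatim from the HodgeCMPerL package; no docstring in the source.) -/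
theorem w_RK4_iff : U.scaleCup.W_RK4 ↔ U.W_RK4 := Iff.rfl
set_option smartUnfolding false in
/-- (Ported verbatim from the HodgeCMPerL package; no docstring in the source.) -/
theorem pohlmannSpan_iff : U.scaleCup.PohlmannSpan ↔ U.PohlmannSpan := Iff.rfl
set_option smartUnfolding false in
/-- (Ported verbatim from the HodgeCMPerL package; no docstring in the source.) -/
theorem cmProdH0Nontrivial_iff : U.scaleCup.CMProdH0Nontrivial ↔ U.CMProdH0Nontrivial := Iff.rfl
set_option smartUnfolding false in
/-- (Ported verbatim from the HodgeCMPerL package; no docstring in the source.) -/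
theorem hc_cm_iff : U.scaleCup.HC_CM ↔ U.HC_CM := Iff.rfl

/-! ### N2, F4, F7, F7d, F7d-B, `Fact_unitH0`, `Qw8MilnePos` transfer -/

set_option smartUnfolding false in
/-- (Ported verbatim from the HodgeCMPerL package; no docstring in the source.) -/
theorem cupC_of_ne {X : U.Var} {i j : ℕ} (h : ¬ (j = 3 ∧ i = 2)) : U.scaleCup.cupC X i j = U.cupC X i j := by
  unfold Universe.cupC
  rw [cup_of_ne h]

set_option smartUnfolding false in
/-- On the rescaled pair, `x ∪' y = (2x) ∪ y` after complexification. -/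
theorem cupC_of_pos {X : U.Var} {i j : ℕ} (h : j = 3 ∧ i = 2) (x : U.CohC X i) (y : U.CohC X j) :
    U.scaleCup.cupC X i j x y = U.cupC X i j ((2 : ℚ) • x) y := by
  induction x using TensorProduct.induction_on with
  | zero => rw [map_zero, LinearMap.zero_apply, smul_zero, map_zero, LinearMap.zero_apply]
  | add x₁ x₂ h₁ h₂ => rw [map_add, LinearMap.add_apply, smul_add, map_add, LinearMap.add_apply, h₁, h₂]
  | tmul a v =>
    induction y using TensorProduct.induction_on with
    | zero => rw [map_zero, map_zero]
    | add y₁ y₂ h₁ h₂ => rw [map_add, map_add, h₁, h₂]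
    | tmul b w =>
      rw [cupC_tmul, cup_of_pos h, LinearMap.smul_apply, LinearMap.smul_apply, TensorProduct.smul_tmul', cupC_tmul,
        ← TensorProduct.smul_tmul, smul_mul_assoc]

set_option smartUnfolding false in
/-- N2 transfers (`F^p` is closed under the rational rescaling). -/
theorem cup_hodge (h : U.Fact_cup_hodge) : U.scaleCup.Fact_cup_hodge := by
  intro X i j p q x y hx hy
  by_cases hc : j = 3 ∧ i = 2
  · rw [cupC_of_pos hc]
    exact h X i j p q _ y (Submodule.smul_of_tower_mem _ (2 : ℚ) hx) hy
  · rw [cupC_of_ne hc]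
    exact h X i j p q x y hx hy

set_option smartUnfolding false in
/-- F4 transfers (even degrees are never the rescaled pair). -/
theorem cupAlg (h : U.Fact_cupAlg) : U.scaleCup.Fact_cupAlg := by
  intro X p q x y hx hy
  rw [cup_of_ne (by omega)]
  exact h X p q x y hx hy

set_option smartUnfolding false in
/-- F7 transfers (the projection formula is in degrees `(k, 2 dim Y')`). -/
theorem gysin (h : U.Fact_gysin) : U.scaleCup.Fact_gysin := by
  intro F n m Ξ pA pB hP
  obtain ⟨gy, halg, hproj⟩ := h F n m Ξ pA pB hP
  refine ⟨gy, halg, fun k e ω => ?_⟩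
  rw [cup_of_ne (by omega)]
  exact hproj k e ω

set_option smartUnfolding false in
/-- F7d transfers. -/
theorem gysinDescent (h : U.Fact_gysinDescent) : U.scaleCup.Fact_gysinDescent := by
  intro F n m Ξ pA pB hP ω hω
  obtain ⟨ha, hb⟩ := h F n m Ξ pA pB hP ω hω
  refine ⟨fun k e he => ha k e ?_, fun p e he => hb p e ?_⟩
  · rw [cup_of_ne (by omega)] at he
    exact he
  · rw [cup_of_ne (by omega)] at he
    exact he

set_option smartUnfolding false in
/-- F7d-B transfers. -/
theorem gysinDescentB (h : U.Fact_gysinDescentB) : U.scaleCup.Fact_gysinDescentB := by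
  intro F n m Ξ pA pB hP ω hω p e he
  refine h F n m Ξ pA pB hP ω hω p e ?_
  rw [cup_of_ne (by omega)] at he
  exact he

set_option smartUnfolding false in
/-- `Fact_unitH0` transfers (`cup X 0 l` is never rescaled). -/
theorem unitH0 (h : U.Fact_unitH0) : U.scaleCup.Fact_unitH0 := by
  obtain ⟨one, h1, h2, h3⟩ := h
  refine ⟨one, h1, fun X l z => ?_, h3⟩
  rw [cup_of_ne (by omega)]
  exact h2 X l z

set_option smartUnfolding false in
/-- Weight-vector records of `U.scaleCup` and of `U` are the same data. -/
def wvecOf {F : CMField} (z : U.scaleCup.WVec F) : U.WVec F :=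
  ⟨z.n, z.Θ, z.p, z.S, z.x, z.ne_zero, z.isWeightVector⟩

set_option smartUnfolding false in
/-- `Qw8MilnePos` transfers (it does not mention cup products). -/
theorem qw8MilnePos (h : U.Qw8MilnePos) : U.scaleCup.Qw8MilnePos := fun F hG h6 z hp ha => h F hG h6 (wvecOf z) hp ha

/-! ### F5 fails -/

/-- **F5 FAILS in `U.scaleCup`** whenever `U` is associative and has a nonzero triple product `(a ∪ b) ∪ c`,
`deg a = 2, deg b = 3, deg c = 1`: associativity in `U.scaleCup` would read `2w = w`. -/
theorem not_fact_cupAssoc (h5 : U.Fact_cupAssoc)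
    (hw : ∃ (X : U.Var) (a : U.Coh X 2) (b : U.Coh X 3) (c : U.Coh X 1), U.cup X (2 + 3) 1 (U.cup X 2 3 a b) c ≠ 0) :
    ¬ U.scaleCup.Fact_cupAssoc := by
  intro h
  obtain ⟨X, a, b, c, hne⟩ := hw
  have e0 : U.cup X (2 + 3) 1 (U.cup X 2 3 a b) c =
      U.castCoh X (Nat.add_assoc 2 3 1).symm (U.cup X 2 (3 + 1) a (U.cup X 3 1 b c)) := h5 X 2 3 1 a b c
  have e1 : U.cup X (2 + 3) 1 (((2 : ℚ) • U.cup X 2 3) a b) c =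
      U.castCoh X (Nat.add_assoc 2 3 1).symm (U.cup X 2 (3 + 1) a (U.cup X 3 1 b c)) := h X 2 3 1 a b c
  rw [LinearMap.smul_apply, LinearMap.smul_apply, map_smul, LinearMap.smul_apply, ← e0, two_smul] at e1
  exact hne (by simpa using e1)

end ScaleCup

/-! ### A nonzero triple product from N1 + F5 + `H⁶ ≠ 0` -/

/-- Under F5, the left-bracketed six-fold product `cupPow X 5 a` re-brackets as `((a₀a₁) ∪ ((a₂a₃)a₄)) ∪ a₅`. -/
theorem cupPow_five_eq (h5 : U.Fact_cupAssoc) (X : U.Var) (a : Fin 6 → U.Coh X 1) :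
    U.cupPow X 5 a = U.cup X (2 + 3) 1 (U.cup X 2 3 (U.cup X 1 1 (a 0) (a 1))
      (U.cup X (1 + 1) 1 (U.cup X 1 1 (a 2) (a 3)) (a 4))) (a 5) := by
  have e3 : U.cup X (2 + 1) 1 (U.cup X 2 1 (U.cup X 1 1 (a 0) (a 1)) (a 2)) (a 3) =
      U.cup X 2 2 (U.cup X 1 1 (a 0) (a 1)) (U.cup X 1 1 (a 2) (a 3)) := h5 X 2 1 1 _ (a 2) (a 3)
  have e2 : U.cup X (2 + 2) 1 (U.cup X 2 2 (U.cup X 1 1 (a 0) (a 1)) (U.cup X 1 1 (a 2) (a 3))) (a 4) =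
      U.cup X 2 3 (U.cup X 1 1 (a 0) (a 1)) (U.cup X (1 + 1) 1 (U.cup X 1 1 (a 2) (a 3)) (a 4)) :=
    h5 X 2 2 1 _ _ (a 4)
  rw [← e2, ← e3]
  rfl

set_option smartUnfolding false in
/-- **A nonzero triple product `(a ∪ b) ∪ c`, `deg = (2, 3, 1)`, exists** as soon as N1 and F5 hold and some CM product has
`H⁶ ≠ 0`: by N1 some `cupPow X 5 a ≠ 0` (the `a₀ ∧ ⋯ ∧ a₅` span `⋀⁶ H¹`), re-bracketed by `cupPow_five_eq`. -/
theorem exists_cup_triple_ne_zero (h1 : U.Fact_cupExterior) (h5 : U.Fact_cupAssoc)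
    (h6 : ∃ (F : CMField) (n : ℕ) (Θ : Fin (n + 1) → CMType F), Nontrivial (U.Coh (U.cmProd F Θ) 6)) :
    ∃ (X : U.Var) (a : U.Coh X 2) (b : U.Coh X 3) (c : U.Coh X 1), U.cup X (2 + 3) 1 (U.cup X 2 3 a b) c ≠ 0 := by
  obtain ⟨F, n, Θ, hN⟩ := h6
  haveI := hN
  obtain ⟨e, he, hea⟩ := h1 F n Θ 5
  obtain ⟨a, ha⟩ : ∃ a : Fin (5 + 1) → U.Coh (U.cmProd F Θ) 1, U.cupPow (U.cmProd F Θ) 5 a ≠ 0 := by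
    by_contra! hall
    obtain ⟨w₀, hw₀⟩ := exists_ne (0 : U.Coh (U.cmProd F Θ) (5 + 1))
    obtain ⟨v, hv⟩ := he.2 w₀
    have hker : ∀ u : ↥(⋀[ℚ]^(5 + 1) (U.Coh (U.cmProd F Θ) 1)), e u = 0 := by
      intro u
      have hu : u ∈ Submodule.span ℚ (Set.range (exteriorPower.ιMulti ℚ (5 + 1) (M := U.Coh (U.cmProd F Θ) 1))) := by
        rw [exteriorPower.ιMulti_span]
        exact Submodule.mem_top
      induction hu using Submodule.span_induction with
      | mem x hx =>
        obtain ⟨a, rfl⟩ := hx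
        rw [hea, hall]
      | zero => exact map_zero e
      | add x y _ _ hx hy => rw [map_add, hx, hy, add_zero]
      | smul r x _ hx => rw [map_smul, hx, smul_zero]
    exact hw₀ (hv.symm.trans (hker v))
  exact ⟨U.cmProd F Θ, _, _, a 5, (cupPow_five_eq h5 (U.cmProd F Θ) a) ▸ ha⟩

end Universe

namespace Toy

open Universe

/-! ### `H⁶` of the CM threefold `A_{(ℚ(ζ₇),Φ)}` (`cyclo7`, `cyclo7_finrank` of `HodgeCM.Model.Inhabited`) -/

/-- `H⁶(A_{(ℚ(ζ₇),Φ)}, ℚ) = ⋀⁶ ℚ⁶ ≠ 0` in the exterior model. -/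
theorem toyModel_exists_nontrivial_H6 :
    ∃ (F : CMField) (n : ℕ) (Θ : Fin (n + 1) → CMType F), Nontrivial (toyModel.Coh (toyModel.cmProd F Θ) 6) := by
  let Θ : Fin (0 + 1) → CMType cyclo7 := fun _ => stdCMType cyclo7
  have hrk : Module.finrank ℚ (toyModel.cmProd cyclo7 Θ).L = 6 := by
    change Module.finrank ℚ (cmObj cyclo7 (Θ 0)).L = 6
    rw [finrank_L_cmObj, cyclo7_finrank]
  have hfin : Module.finrank ℚ ↥(⋀[ℚ]^6 (toyModel.cmProd cyclo7 Θ).L) = 1 := by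
    haveI : Module.Free ℚ (toyModel.cmProd cyclo7 Θ).L := Module.Free.of_divisionRing ℚ _
    rw [exteriorPower.finrank_eq, hrk]
    rfl
  have hN : Nontrivial ↥(⋀[ℚ]^6 (toyModel.cmProd cyclo7 Θ).L) := Module.nontrivial_of_finrank_eq_succ hfin
  exact ⟨cyclo7, 0, Θ, hN⟩

/-- A nonzero `(a ∪ b) ∪ c` with `deg = (2, 3, 1)` in `toyModel`. -/
theorem toyModel_exists_cup_triple_ne_zero :
    ∃ (X : toyModel.Var) (a : toyModel.Coh X 2) (b : toyModel.Coh X 3) (c : toyModel.Coh X 1),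
      toyModel.cup X (2 + 3) 1 (toyModel.cup X 2 3 a b) c ≠ 0 :=
  exists_cup_triple_ne_zero toyModel_fact_cupExterior (fact_cupAssoc exteriorHodgeData) toyModel_exists_nontrivial_H6

/-! ### The rescaled exterior model -/

/-- **`cupModel`**: the exterior model with `cup X 2 3` doubled. -/
def cupModel : Universe := toyModel.scaleCup

/-- (Ported verbatim from the HodgeCMPerL package; no docstring in the source.) -/
theorem cupModel_def : cupModel = toyModel.scaleCup := rfl

/-- (Ported verbatim from the HodgeCMPerL package; no docstring in the source.) -/
theorem cupModel_modelAxioms : cupModel.ModelAxioms := ScaleCup.modelAxioms toyModel_modelAxioms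
/-- (Ported verbatim from the HodgeCMPerL package; no docstring in the source.) -/
theorem cupModel_fact_cupExterior : cupModel.Fact_cupExterior := ScaleCup.fact_cupExterior_iff.mpr toyModel_fact_cupExterior
/-- (Ported verbatim from the HodgeCMPerL package; no docstring in the source.) -/
theorem cupModel_fact_cup_hodge : cupModel.Fact_cup_hodge := ScaleCup.cup_hodge toyModel_fact_cup_hodge
/-- (Ported verbatim from the HodgeCMPerL package; no docstring in the source.) -/
theorem cupModel_fact_pull_H0 : cupModel.Fact_pull_H0 := ScaleCup.fact_pull_H0_iff.mpr toyModel_fact_pull_H0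
/-- (Ported verbatim from the HodgeCMPerL package; no docstring in the source.) -/
theorem cupModel_fact_hodge_F0 : cupModel.Fact_hodge_F0 := ScaleCup.fact_hodge_F0_iff.mpr toyModel_fact_hodge_F0
/-- (Ported verbatim from the HodgeCMPerL package; no docstring in the source.) -/
theorem cupModel_fact_cupAlg : cupModel.Fact_cupAlg := ScaleCup.cupAlg fact_cupAlg
/-- (Ported verbatim from the HodgeCMPerL package; no docstring in the source.) -/
theorem cupModel_fact_gysin : cupModel.Fact_gysin := ScaleCup.gysin toyModel_fact_gysin
/-- (Ported verbatim from the HodgeCMPerL package; no docstring in the source.) -/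
theorem cupModel_fact_gysinDescent : cupModel.Fact_gysinDescent := ScaleCup.gysinDescent toyModel_fact_gysinDescent
/-- (Ported verbatim from the HodgeCMPerL package; no docstring in the source.) -/
theorem cupModel_fact_gysinDescentB : cupModel.Fact_gysinDescentB := ScaleCup.gysinDescentB toyModel_fact_gysinDescentB
/-- (Ported verbatim from the HodgeCMPerL package; no docstring in the source.) -/
theorem cupModel_fact_unitH0 : cupModel.Fact_unitH0 := ScaleCup.unitH0 toyModel_fact_unitH0
/-- (Ported verbatim from the HodgeCMPerL package; no docstring in the source.) -/
theorem cupModel_fact_fundClass : cupModel.Fact_fundClass := ScaleCup.fact_fundClass_iff.mpr toyModel_fact_fundClass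
/-- (Ported verbatim from the HodgeCMPerL package; no docstring in the source.) -/
theorem cupModel_fact_dimProd : cupModel.Fact_dimProd := ScaleCup.fact_dimProd_iff.mpr toyModel_fact_dimProd
/-- (Ported verbatim from the HodgeCMPerL package; no docstring in the source.) -/
theorem cupModel_w_rk4 : cupModel.W_RK4 := ScaleCup.w_RK4_iff.mpr toyModel_w_rk4
/-- (Ported verbatim from the HodgeCMPerL package; no docstring in the source.) -/
theorem cupModel_pohlmannSpan : cupModel.PohlmannSpan := ScaleCup.pohlmannSpan_iff.mpr toyModel_pohlmannSpan'
/-- (Ported verbatim from the HodgeCMPerL package; no docstring in the source.) -/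
theorem cupModel_qw8MilnePos : cupModel.Qw8MilnePos := ScaleCup.qw8MilnePos toyModel_qw8MilnePos
/-- (Ported verbatim from the HodgeCMPerL package; no docstring in the source.) -/
theorem cupModel_cmProdH0Nontrivial : cupModel.CMProdH0Nontrivial :=
  ScaleCup.cmProdH0Nontrivial_iff.mpr (cmProdH0Nontrivial exteriorHodgeData)
/-- (Ported verbatim from the HodgeCMPerL package; no docstring in the source.) -/
theorem cupModel_hc_cm : cupModel.HC_CM := ScaleCup.hc_cm_iff.mpr toyModel_hc_cm

/-- **F5 FAILS in `cupModel`.** -/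
theorem not_cupModel_fact_cupAssoc : ¬ cupModel.Fact_cupAssoc :=
  ScaleCup.not_fact_cupAssoc (fact_cupAssoc exteriorHodgeData) toyModel_exists_cup_triple_ne_zero

/-! ### Independence of F5 -/

/-- The statements both models satisfy: the whole descent profile of `toyModel` except F5. -/
def CupContext (U : Universe) : Prop :=
  U.ModelAxioms ∧ U.Fact_cupExterior ∧ U.Fact_cup_hodge ∧ U.Fact_pull_H0 ∧ U.Fact_hodge_F0 ∧ U.Fact_cupAlg ∧
    U.Fact_gysin ∧ U.Fact_gysinDescent ∧ U.Fact_gysinDescentB ∧ U.Fact_unitH0 ∧ U.Fact_fundClass ∧ U.Fact_dimProd ∧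
    U.W_RK4 ∧ U.PohlmannSpan ∧ U.Qw8MilnePos ∧ U.CMProdH0Nontrivial

/-- (Ported verbatim from the HodgeCMPerL package; no docstring in the source.) -/
theorem toyModel_cupContext : CupContext toyModel :=
  ⟨toyModel_modelAxioms, toyModel_fact_cupExterior, toyModel_fact_cup_hodge, toyModel_fact_pull_H0, toyModel_fact_hodge_F0,
    fact_cupAlg, toyModel_fact_gysin, toyModel_fact_gysinDescent, toyModel_fact_gysinDescentB, toyModel_fact_unitH0,
    toyModel_fact_fundClass, toyModel_fact_dimProd, toyModel_w_rk4, toyModel_pohlmannSpan', toyModel_qw8MilnePos,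
    cmProdH0Nontrivial exteriorHodgeData⟩

/-- (Ported verbatim from the HodgeCMPerL package; no docstring in the source.) -/
theorem cupModel_cupContext : CupContext cupModel :=
  ⟨cupModel_modelAxioms, cupModel_fact_cupExterior, cupModel_fact_cup_hodge, cupModel_fact_pull_H0, cupModel_fact_hodge_F0,
    cupModel_fact_cupAlg, cupModel_fact_gysin, cupModel_fact_gysinDescent, cupModel_fact_gysinDescentB, cupModel_fact_unitH0,
    cupModel_fact_fundClass, cupModel_fact_dimProd, cupModel_w_rk4, cupModel_pohlmannSpan, cupModel_qw8MilnePos,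
    cupModel_cmProdH0Nontrivial⟩

/-- the two profiles side by side (both models also satisfy `HC_CM`) -/
theorem cupModel_profile : CupContext cupModel ∧ ¬ cupModel.Fact_cupAssoc ∧ cupModel.HC_CM :=
  ⟨cupModel_cupContext, not_cupModel_fact_cupAssoc, cupModel_hc_cm⟩

/-- (Ported verbatim from the HodgeCMPerL package; no docstring in the source.) -/
theorem toyModel_cupProfile : CupContext toyModel ∧ toyModel.Fact_cupAssoc ∧ toyModel.HC_CM :=
  ⟨toyModel_cupContext, fact_cupAssoc exteriorHodgeData, toyModel_hc_cm⟩

/-- **F5 `Fact_cupAssoc` is INDEPENDENT of `ModelAxioms ∧ N1–N4 ∧ F4 ∧ F7 ∧ F7d ∧ F7d-B ∧ Fact_unitH0 ∧ N5 ∧ Fact_dimProd ∧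
W_RK4 ∧ PohlmannSpan ∧ Qw8MilnePos ∧ CMProdH0Nontrivial`** (`toyModel`: true; `cupModel`: false). -/
theorem fact_cupAssoc_independent :
    (∃ U : Universe, CupContext U ∧ U.Fact_cupAssoc) ∧ (∃ U : Universe, CupContext U ∧ ¬ U.Fact_cupAssoc) :=
  ⟨⟨toyModel, toyModel_cupContext, fact_cupAssoc exteriorHodgeData⟩, ⟨cupModel, cupModel_cupContext, not_cupModel_fact_cupAssoc⟩⟩

/-- Equivalently: F5 is not a consequence of the list. -/
theorem not_fact_cupAssoc_of_cupContext : ¬ ∀ U : Universe, CupContext U → U.Fact_cupAssoc :=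
  fun h => not_cupModel_fact_cupAssoc (h cupModel cupModel_cupContext)

end Toy

end HodgeCM

end

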